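import Literature.AlgebraicGeometry.AbelianSchemes.PolarizedAbelianSchemeLocalEmbedding   -- ★ REL-EMB-SPREAD′ (chart clause tokens)
import Literature.AlgebraicGeometry.AbelianSchemes.PolarizedTupleEmbeddingBaseChange      -- ★ (b3) `nonempty_pullback_LDelta_tensorPow_iso_of_tupleRel`
import Literature.AlgebraicGeometry.AbelianSchemes.TupleRelBaseChangeUnique               -- ★ canonical base-change clauses
import Literature.AlgebraicGeometry.Motives.GeneratingSectionsSerreTwistClass             -- ★ `nonempty_twistMod_toProj_iso` ([Hartshorne1977] II Thm. 7.1)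
import HarnessLib

/-!
# The REL-EMB chart of a polarised abelian scheme, read as a projective embedding OF THE PULLED-BACK TUPLE with `𝒪(1)| ≅ L^Δ(λ_ι)^{⊗3}`
# (organ (GS-3b1′) of the `stub_INJ0` payer)

Topic `AlgebraicGeometry/AbelianSchemes`; namespace `Literature.AlgebraicGeometry.AbelianSchemes.AbelianSchemeOver`.  THEOREMS ONLY (no definition, no instance,
no notation, no named fact, no `sorry`); universe `Scheme.{0}`.  Cell `hodgecm-mathlib` (D-0151), P6 «MOD programme» (crux hLiu418 = stmt-HodgeConjecture-24832,
`--supports`, count-neutral); P-LINE ED. 2 leaf `Lines/F0_P6a_PELSpread.lean`, socket `stub_INJ0` (LEAD F0P6-plan (g3) «M-55b» (2) STAGE CUT; A-p14 (g35) census v2 row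
(b1)).  HC_CM is proved only modulo the printed citations until rung 0 closes; nothing here is about HC.

THE MATHEMATICS ([EGAIII1] (4.7.1); [Hartshorne1977] II Thm. 7.1; [MumfordFogartyKirwan1994] Prop. 6.10, Def. 7.2).  ★ REL-EMB-SPREAD′
`exists_opens_finite_image_compl_forall_affineOpen_isClosedImmersion_toProj'` hands, at a chart `ι : Spec R ↪ T`, for EVERY cartesian square `A′ = A ×_T Spec R`,
generating sections `b` of `L^Δ(λ)^{⊗3}|_{A′}` whose morphism `toProj : A′ → 𝐏^m_R` is a closed immersion.  At the SIMPLE square `A′ := (𝒜 ×_T ι)` this is a closed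
`Spec R`-immersion `φ : (𝒜 ×_T ι) ↪ 𝐏^m_R` (`φ ≫ (𝐏^m_R → Spec R) =` structure map, ★ `toProj_toSpec`) with `φ^*𝒪(1) ≅ (L^Δ(λ)^{⊗3})|_{A′}` ([Hartshorne1977] II
Thm. 7.1, ★ `nonempty_twistMod_toProj_iso`) `≅ L^Δ(λ_ι)^{⊗3}` — the Mumford bundle OF THE PULLED-BACK polarisation `λ_ι` with its own graph `(1, λ_ι)` (★ (b3)
`nonempty_pullback_LDelta_tensorPow_iso_of_tupleRel` along the canonical relation of `𝒜 ×_T ι` to `𝒜`).  The consumer converts `𝐏^m_R ≅ 𝐏(Fin m; Spec R)`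
(«L4» LA4-p03 (b1)) and feeds ★ (b0″) `exists_isomPieces_of_forall_exists_chart'`.

* `exists_toProj_chart_of_relEmb` — THE HEAD.

## References
* [EGAIII1] A. Grothendieck, *ÉGA III₁*, Publ. Math. IHÉS 11 (1961), Thm. (4.7.1) (p. 145).
* [Hartshorne1977] R. Hartshorne, *Algebraic Geometry* (1977), II Thm. 7.1 (p. 150).
* [MumfordFogartyKirwan1994] D. Mumford, J. Fogarty, F. Kirwan, *Geometric Invariant Theory*, 3rd ed. (1994), Ch. 6 §2 Prop. 6.10 (p. 121); Ch. 7 §2 Def. 7.2 (p. 129), Prop. 7.6 (p. 136).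
-/

set_option autoImplicit false

noncomputable section

-- Mathlib's `Over`/pull-back API is stated across semireducible wrappers (as in the ★ `AbelianSchemes/*` files).
set_option backward.isDefEq.respectTransparency false

open CategoryTheory CategoryTheory.Limits AlgebraicGeometry TopologicalSpace Opposite

namespace Literature.AlgebraicGeometry.AbelianSchemes

namespace AbelianSchemeOver

open Literature.AlgebraicGeometry.Morphisms Literature.AlgebraicGeometry.Morphisms.ProjCech
open Literature.AlgebraicGeometry.Modules Literature.AlgebraicGeometry.Modules.SerreTwist Literature.AlgebraicGeometry.Motives
open Literature.AlgebraicGeometry.Motives.GeneratingSections Literature.AlgebraicGeometry.AbelianVarieties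

/-- **(GS-3b1′) THE REL-EMB CHART AS AN EMBEDDING OF THE PULLED-BACK TUPLE.**  `𝒜/T` with a polarisation `pol` (graph `Gr = (1, λ)`), a rank-one frame system
`F` of `L^Δ(λ)^{⊗3} = (Gr^*𝒫)^{⊗3}`, a chart `ι : Spec R → T` carrying the chart clause of ★ REL-EMB-SPREAD′ VERBATIM (`hemb`).  Then the pulled-back tuple
`𝒜 ×_T ι` over `Spec R` has: its graph `Gr′ = (1, λ_ι)`, some `m`, and a CLOSED IMMERSION `φ : (𝒜 ×_T ι) → 𝐏^m_R` OVER `Spec R` with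
`φ^*𝒪(1) = twistMod φ 𝒪 1 ≅ (Gr′^*𝒫_ι)^{⊗3}`. [cite: EGAIII1, Thm. (4.7.1) p. 145] [cite: Hartshorne1977, II Thm. 7.1 (p. 150)]
[cite: MumfordFogartyKirwan1994, Ch. 6 §2 Prop. 6.10 (p. 121) and Ch. 7 §2 Definition 7.2 (p. 129)] -/
theorem exists_toProj_chart_of_relEmb {R : Type} [CommRing R] {T : Scheme.{0}} (𝒜 : AbelianSchemeOver T) (D : 𝒜.DualPair)
    (pol : 𝒜.Polarization D) (Gr : 𝒜.X.left ⟶ 𝒜.prodLeft D.hat) (hGr₁ : Gr ≫ pullback.fst 𝒜.X.hom D.hat.X.hom = 𝟙 _)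
    (hGr₂ : Gr ≫ pullback.snd 𝒜.X.hom D.hat.X.hom = pol.lam.left)
    (F : FrameSystem (tensorPow ((Scheme.Modules.pullback Gr).obj D.P) 3)) (h1 : ∀ x, F.rank x = 1) (ι : Spec (.of R) ⟶ T)
    (hemb : ∀ {X' : Scheme.{0}} (i' : X' ⟶ 𝒜.X.left) (f' : X' ⟶ Spec (.of R)), IsPullback i' f' 𝒜.X.hom ι →
      ∃ (m : ℕ) (b : Fin (m + 1) → Γ((Scheme.Modules.pullback i').obj (tensorPow ((Scheme.Modules.pullback Gr).obj D.P) 3), ⊤))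
        (hcov' : ⨆ i, ⨆ z, X'.basicOpen ((CocycleSections.ofFrameSystem (F.pullback i') (fun z ↦ h1 (i'.base z))
          b).coeff i z) = ⊤),
        IsClosedImmersion ((ofCocycleSections (F.pullback i').U (CocycleSections.ofFrameSystem (F.pullback i')
          (fun z ↦ h1 (i'.base z)) b) hcov').toProj f')) :
    ∃ (Gr' : (𝒜.baseChange ι).X.left ⟶ (𝒜.baseChange ι).prodLeft (D.baseChange ι).hat) (m : ℕ)
      (φ : (𝒜.baseChange ι).X.left ⟶ PP R m),
      Gr' ≫ pullback.fst (𝒜.baseChange ι).X.hom (D.baseChange ι).hat.X.hom = 𝟙 _ ∧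
      Gr' ≫ pullback.snd (𝒜.baseChange ι).X.hom (D.baseChange ι).hat.X.hom = (pol.baseChange ι).lam.left ∧
      φ ≫ toSpec R m = (𝒜.baseChange ι).X.hom ∧ IsClosedImmersion φ ∧
      Nonempty (twistMod φ (unitModule _) 1 ≅ tensorPow ((Scheme.Modules.pullback Gr').obj (D.baseChange ι).P) 3) := by
  -- the graph `(1, λ_ι)` of the pulled-back polarisation
  let Gr' : (𝒜.baseChange ι).X.left ⟶ (𝒜.baseChange ι).prodLeft (D.baseChange ι).hat :=
    pullback.lift (𝟙 _) (pol.baseChange ι).lam.left (by rw [Category.id_comp]; exact (Over.w (pol.baseChange ι).lam).symm)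
  have hGr'₁ : Gr' ≫ pullback.fst (𝒜.baseChange ι).X.hom (D.baseChange ι).hat.X.hom = 𝟙 _ := pullback.lift_fst _ _ _
  have hGr'₂ : Gr' ≫ pullback.snd (𝒜.baseChange ι).X.hom (D.baseChange ι).hat.X.hom = (pol.baseChange ι).lam.left :=
    pullback.lift_snd _ _ _
  -- REL-EMB′ at the SIMPLE square `𝒜 ×_T ι`
  have hsq : IsPullback (pullback.fst 𝒜.X.hom ι) (𝒜.baseChange ι).X.hom 𝒜.X.hom ι := IsPullback.of_hasPullback 𝒜.X.hom ι
  obtain ⟨m, b, hcov', hcl⟩ := hemb (pullback.fst 𝒜.X.hom ι) (𝒜.baseChange ι).X.hom hsq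
  refine ⟨Gr', m, _, hGr'₁, hGr'₂, toProj_toSpec _ _, hcl, ?_⟩
  -- `𝒪(1)| ≅ (L^Δ(λ)^{⊗3})|_{A′}` ([Hartshorne1977] II 7.1) `≅ L^Δ(λ_ι)^{⊗3}` (★ (b3) along the canonical relation)
  obtain ⟨e₁⟩ := nonempty_twistMod_toProj_iso (𝒜.baseChange ι).X.hom (F.pullback (pullback.fst 𝒜.X.hom ι))
    (fun z ↦ h1 ((pullback.fst 𝒜.X.hom ι).base z)) b hcov'
  obtain ⟨e₂⟩ := nonempty_pullback_LDelta_tensorPow_iso_of_tupleRel ι D (D.baseChange ι) pol.lam (pol.baseChange ι).lam Gr hGr₁ hGr₂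
    Gr' hGr'₁ hGr'₂ (pullback.fst 𝒜.X.hom ι) (pullback.fst D.hat.X.hom ι) pullback.condition.symm pullback.condition.symm
    (pol.baseChange_lam_left_comp_fst ι) (D.nonempty_pullback_map_P_iso_baseChange_P ι _ _) 3
  exact ⟨e₁ ≪≫ e₂⟩

end AbelianSchemeOver

end Literature.AlgebraicGeometry.AbelianSchemes

end
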